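import Literature.NumberTheory.Sieve.HeathBrownCubicUpperBoundWeights
import Literature.NumberTheory.LFunctions.DegreeOnePrimesPNT
import HarnessLib

/-!
# Chain sums for Heath-Brown's Lemma 3.7: `e_k ≤ p_1^k/k!`, norm-pattern bookkeeping, sharp Mertens windows

Pure-proof tools (no definitions) for the deduction of **Lemma 3.7 from the corrected Lemma 7.1** in
D. R. Heath-Brown, *Primes represented by `x³ + 2y³`*, Acta Math. 186 (2001), 1–84, §7 pp. 42–47
(part of the decomposition of **parity.S18**,
`Literature.NumberTheory.Sieve.setOf_prime_cube_add_two_mul_cube_infinite`). The proof of Lemma 3.7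
applies Lemma 7.1 "repeatedly" to families of ideals `Q = P_1⋯P_{n+1}` (products of first-degree
prime ideals in prescribed norm ranges) and then estimates the ideal weight
`∑_{N(Q)∈𝒬} N(Q)^{-1}` by (7.4), p. 42:
`∑ N(Q)^{-1} ≤ (∑_{window} N(P)^{-1}) · (1/n!) (∑_{X^τ ≤ N(P) < X^{1−τ}} N(P)^{-1})^n ≪ ξτ^{-1}(log τ^{-1})^n/n!`,
summed over `n ≪ τ^{-1}`. Two features of this bookkeeping drive the design here:

* the families are described by conditions on the NORMS only, so we index them by *norm patterns*
  `σ ⊂ ℕ` (finite sets of rational primes) and use Lemma 7.1 in its `normIn` form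
  (`HeathBrown2001_lemma_7_1_normWeighted`: all ideals whose norm lies in a set `𝒬` of square-free
  integers), the weight being `∑_{q∈𝒬} c_K(q)/q` with `c_K(q) = #{Q : N(Q) = q}`
  (`Literature.NumberTheory.LFunctions.idealNormCount`, multiplicative on coprime arguments);
* the constant in front of `log τ^{-1}` must be exactly `1` (it is exponentiated: `∑_n (log τ^{-1})^n/n! = τ^{-1}`),
  so the Mertens estimate for the first-degree prime ideals is needed in its sharp form
  `∑_{p} c_K(p)/p = log log x + c + O(1/log x)` — the tree's
  `Literature.NumberTheory.LFunctions.NumberField.sum_primesLE_idealNormCount_div_eq` (Landau) — rather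
  than the bound by `3 ∑_p 1/p` of `HeathBrownCubicUpperBoundTools` (adequate for Lemma 3.6 only).

## Content (namespace `Literature.NumberTheory.Sieve.CubicSieve`), everything PROVED

* `factorial_mul_esymm_le_pow`, `esymm_le_pow_div_factorial` — `k!·e_k(w) ≤ (∑ w)^k` for
  non-negative weights on a finite set (the inequality behind (7.4)); `esymm_nonneg`, `esymm_mono`.
* `sum_sel_le`, `sum_sel₂_le` — singling out one (resp. two) distinguished member(s) of each set of a
  family of `(k+1)`- (resp. `(k+2)`-) subsets: if the distinguished members always satisfy a
  condition of total weight `≤ B`, the family has weight `≤ B·e_k` (the device "we fix `i`, so that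
  the sum over `P_{i−1}` produces `O(ξτ^{-1})`; the remaining prime ideals produce a factor
  `O((log τ^{-1})^n/n!)`", p. 43).
* `sum_normIn_inv_absNorm_eq` (`∑_{N(Q)∈𝒬} N(Q)^{-1} = ∑_{q∈𝒬} c_K(q)/q`), `idealNormCount_prod_primes`
  and `normWt_prod_primes` (`c_K(∏σ)/∏σ = ∏_{p∈σ} c_K(p)/p` for distinct primes),
  `sum_image_prod_normWt_le` (the weight of a family of norms given by patterns).
* `dyadic_sum_normIn_le` — the corrected Lemma 7.1 in `normIn` form summed over the dyadic blocks of a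
  range `[a, b)`, `b ≤ X^{2−2τ}` ((7.3), p. 42).
* `exists_sum_normWt_window_le` — **sharp Mertens windows**: `C₁ ≥ 0` with
  `∑_{lo < p ≤ hi} c_K(p)/p ≤ log(log hi/log lo) + C₁/log lo` for `2 ≤ lo ≤ hi` ((7.1)–(7.2));
  `log_log_div_log_le` (`log(log hi/log lo) ≤ log(hi/lo)/log lo`).

## References

* D. R. Heath-Brown, *Primes represented by `x³ + 2y³`*, Acta Math. 186 (2001), 1–84: §7, (7.1)–(7.4)
  and pp. 42–44. [cite: HeathBrownActa2001, §7 (7.1)–(7.4)]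
* G. Harman, *Prime-Detecting Sieves*, LMS Monographs 33, Princeton (2007), §13.2. [cite: Harman2007, §13.2]

## Mathlib / tree search

Mathlib: `Finset.powersetCard_succ_insert`, `Finset.powersetCard_eq_empty`, `Finset.mul_prod_erase`,
`Finset.sum_image`, `Finset.sum_image_le_of_nonneg`, `Finset.sum_fiberwise_of_maps_to`,
`Nat.Coprime.prod_right`, `Real.log_le_sub_one_of_pos` (no elementary-symmetric-sum inequality for
real weights was found: searched `esymm`, `powersetCard` with `prod_le`). Tree:
`HeathBrownCubicUpperBound` (`normIn`), `HeathBrownCubicUpperBoundTools` (`dyadIdx`, `dyadic_sum_le`,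
whose proof is re-run here with the weight `c_K(q)/q`), `HeathBrownCubicUpperBoundWeights`
(`card_filter_normIn_absNorm_eq`), `Literature.NumberTheory.LFunctions.IdealNormCount`
(`idealNormCount_mul_of_coprime`), `…DegreeOnePrimesPNT` (`sum_primesLE_idealNormCount_div_eq`).
-/

noncomputable section

open Polynomial NumberField Finset Filter Topology Asymptotics
open scoped nonZeroDivisors

namespace Literature.NumberTheory.Sieve.CubicSieve

open LFunctions.CubeRootTwoField CubicPrimes

/-! ### Elementary symmetric sums: `e_k(w) ≤ (∑ w)^k / k!` -/

section Esymm

variable {α : Type*} [DecidableEq α]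

/-- `W^{k+1} + (k+1)·w·W^k ≤ (W + w)^{k+1}` for `W, w ≥ 0` (the first two terms of the binomial
expansion). [folklore] -/
theorem pow_add_mul_pow_le_add_pow {W w : ℝ} (hW : 0 ≤ W) (hw : 0 ≤ w) (k : ℕ) :
    W ^ (k + 1) + (k + 1) * w * W ^ k ≤ (W + w) ^ (k + 1) := by
  induction k with
  | zero => simp
  | succ k ih =>
    have h1 : (W + w) ^ (k + 2) = (W + w) ^ (k + 1) * (W + w) := by ring
    have h2 : 0 ≤ (k + 1 : ℝ) * w * W ^ k * w := by positivity
    calc W ^ (k + 2) + ((k + 1 : ℕ) + 1 : ℝ) * w * W ^ (k + 1)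
        = (W ^ (k + 1) + (k + 1) * w * W ^ k) * (W + w) - (k + 1) * w * W ^ k * w := by
          push_cast; ring
      _ ≤ (W + w) ^ (k + 1) * (W + w) - 0 := by
          gcongr
      _ = (W + w) ^ (k + 2) := by ring

/-- **`k! · e_k ≤ p_1^k`**: for non-negative weights, `k!` times the `k`-th elementary symmetric sum
`∑_{t ⊆ s, #t = k} ∏_{a∈t} w(a)` is at most `(∑_{a∈s} w(a))^k` (each `k`-set arises from `k!`
ordered `k`-tuples). This is the inequality behind (7.4), p. 42:
`∑ N(Q)^{-1} ≤ (1/n!) (∑_{P} N(P)^{-1})^n`. [cite: HeathBrownActa2001, §7 (7.4)] -/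
theorem factorial_mul_esymm_le_pow (s : Finset α) (w : α → ℝ) (hw : ∀ a ∈ s, 0 ≤ w a) (k : ℕ) :
    (k.factorial : ℝ) * ∑ t ∈ s.powersetCard k, ∏ a ∈ t, w a ≤ (∑ a ∈ s, w a) ^ k := by
  induction s using Finset.induction_on generalizing k with
  | empty =>
    cases k with
    | zero => simp
    | succ k =>
      have : (∅ : Finset α).powersetCard (k + 1) = ∅ :=
        powersetCard_eq_empty.mpr (by simp)
      simp [this]
  | insert a s ha ih =>
    have hwa : 0 ≤ w a := hw a (mem_insert_self a s)
    have hws : ∀ b ∈ s, 0 ≤ w b := fun b hb => hw b (mem_insert_of_mem hb)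
    have hW : 0 ≤ ∑ b ∈ s, w b := sum_nonneg hws
    cases k with
    | zero => simp
    | succ k =>
      rw [powersetCard_succ_insert ha, sum_union, sum_insert ha]
      · -- the two parts
        have hdisj : ∀ t ∈ s.powersetCard k, a ∉ t := fun t ht hat =>
          ha ((mem_powersetCard.mp ht).1 hat)
        have himg : ∑ t ∈ (s.powersetCard k).image (insert a), ∏ b ∈ t, w b =
            w a * ∑ t ∈ s.powersetCard k, ∏ b ∈ t, w b := by
          rw [sum_image, mul_sum]
          · exact sum_congr rfl fun t ht => by rw [prod_insert (hdisj t ht)]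
          · intro t₁ ht₁ t₂ ht₂ h
            rw [← erase_insert (hdisj t₁ ht₁), h, erase_insert (hdisj t₂ ht₂)]
        rw [himg]
        have e1 := ih hws (k + 1)
        have e2 := ih hws k
        have hk : ((k + 1).factorial : ℝ) = (k + 1) * k.factorial := by
          rw [Nat.factorial_succ]; push_cast; ring
        have hes0 : 0 ≤ ∑ t ∈ s.powersetCard k, ∏ b ∈ t, w b :=
          sum_nonneg fun t ht => prod_nonneg fun b hb => hws b ((mem_powersetCard.mp ht).1 hb)
        calc ((k + 1).factorial : ℝ) * (∑ t ∈ s.powersetCard (k + 1), ∏ b ∈ t, w b +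
              w a * ∑ t ∈ s.powersetCard k, ∏ b ∈ t, w b)
            = (k + 1).factorial * ∑ t ∈ s.powersetCard (k + 1), ∏ b ∈ t, w b +
                (k + 1) * w a * (k.factorial * ∑ t ∈ s.powersetCard k, ∏ b ∈ t, w b) := by
              rw [hk]; ring
          _ ≤ (∑ b ∈ s, w b) ^ (k + 1) + (k + 1) * w a * (∑ b ∈ s, w b) ^ k := by
              gcongr
          _ ≤ (∑ b ∈ s, w b + w a) ^ (k + 1) := pow_add_mul_pow_le_add_pow hW hwa k
          _ = (w a + ∑ b ∈ s, w b) ^ (k + 1) := by rw [add_comm]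
      · rw [disjoint_left]
        intro t ht himg
        obtain ⟨t', ht', rfl⟩ := mem_image.mp himg
        exact ha ((mem_powersetCard.mp ht).1 (mem_insert_self a t'))

/-- `e_k(w) ≤ (∑ w)^k / k!` (`factorial_mul_esymm_le_pow` divided through). [cite: HeathBrownActa2001, §7 (7.4)] -/
theorem esymm_le_pow_div_factorial (s : Finset α) (w : α → ℝ) (hw : ∀ a ∈ s, 0 ≤ w a) (k : ℕ) :
    ∑ t ∈ s.powersetCard k, ∏ a ∈ t, w a ≤ (∑ a ∈ s, w a) ^ k / k.factorial := by
  rw [le_div_iff₀ (by positivity), mul_comm]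
  exact factorial_mul_esymm_le_pow s w hw k

omit [DecidableEq α] in
/-- The elementary symmetric sums of non-negative weights are non-negative. [folklore] -/
theorem esymm_nonneg (s : Finset α) (w : α → ℝ) (hw : ∀ a ∈ s, 0 ≤ w a) (k : ℕ) :
    0 ≤ ∑ t ∈ s.powersetCard k, ∏ a ∈ t, w a :=
  sum_nonneg fun _ ht => prod_nonneg fun b hb => hw b ((mem_powersetCard.mp ht).1 hb)

omit [DecidableEq α] in
/-- The elementary symmetric sums are monotone in the underlying set (non-negative weights). [folklore] -/
theorem esymm_mono {s s' : Finset α} (h : s ⊆ s') (w : α → ℝ) (hw : ∀ a ∈ s', 0 ≤ w a) (k : ℕ) :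
    ∑ t ∈ s.powersetCard k, ∏ a ∈ t, w a ≤ ∑ t ∈ s'.powersetCard k, ∏ a ∈ t, w a :=
  sum_le_sum_of_subset_of_nonneg (powersetCard_mono h) fun _ ht _ =>
    prod_nonneg fun b hb => hw b ((mem_powersetCard.mp ht).1 hb)

/-! ### Selector sums: singling out one or two members of each `k`-set -/

/-- **One distinguished member.** Let `sel` pick a member `sel σ ∈ σ` of each set in a family
`A` of `(k+1)`-subsets of `s`, and suppose the selected member always satisfies a condition
`pred (σ ∖ {sel σ}) (sel σ)` whose total weight is uniformly bounded:
`∑_{p ∈ s, p ∉ σ', pred σ' p} w(p) ≤ B` for every `k`-subset `σ'`. Then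
`∑_{σ ∈ A} ∏_{σ} w ≤ B · e_k(s)` (re-index by `σ ↦ (σ ∖ {sel σ}, sel σ)`, which is injective).
This is the device "we fix `i`, so that the sum over `P_{i−1}` produces `O(ξτ^{-1})` … the remaining
prime ideals produce a factor `O((log τ^{-1})^n/n!)`" of p. 43. [cite: HeathBrownActa2001, §7 p. 43] -/
theorem sum_sel_le (s : Finset α) (w : α → ℝ) (hw : ∀ a ∈ s, 0 ≤ w a) (k : ℕ)
    (A : Finset (Finset α)) (hA : A ⊆ s.powersetCard (k + 1))
    (sel : Finset α → α) (hsel : ∀ σ ∈ A, sel σ ∈ σ)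
    (pred : Finset α → α → Prop) [∀ σ p, Decidable (pred σ p)]
    (hpred : ∀ σ ∈ A, pred (σ.erase (sel σ)) (sel σ))
    {B : ℝ} (hB : ∀ σ' ∈ s.powersetCard k, ∑ p ∈ s.filter (fun p => p ∉ σ' ∧ pred σ' p), w p ≤ B) :
    ∑ σ ∈ A, ∏ a ∈ σ, w a ≤ B * ∑ σ' ∈ s.powersetCard k, ∏ a ∈ σ', w a := by
  classical
  set φ : Finset α → Finset α × α := fun σ => (σ.erase (sel σ), sel σ) with hφ
  set g : Finset α × α → ℝ := fun x => w x.2 * ∏ a ∈ x.1, w a with hg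
  have hinj : Set.InjOn φ A := by
    intro σ₁ h₁ σ₂ h₂ h
    simp only [hφ, Prod.mk.injEq] at h
    rw [← insert_erase (hsel σ₁ h₁), h.1, h.2, insert_erase (hsel σ₂ h₂)]
  have hLHS : ∑ σ ∈ A, ∏ a ∈ σ, w a = ∑ x ∈ A.image φ, g x := by
    rw [sum_image hinj]
    refine sum_congr rfl fun σ hσ => ?_
    simp only [hg, hφ]
    rw [← mul_prod_erase σ w (hsel σ hσ)]
  set T : Finset (Finset α × α) :=
    (s.powersetCard k ×ˢ s).filter (fun x => x.2 ∉ x.1 ∧ pred x.1 x.2) with hT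
  have hsub : A.image φ ⊆ T := by
    intro x hx
    obtain ⟨σ, hσ, rfl⟩ := mem_image.mp hx
    have hσs := mem_powersetCard.mp (hA hσ)
    simp only [hT, hφ, mem_filter, mem_product, mem_powersetCard]
    refine ⟨⟨⟨(erase_subset _ _).trans hσs.1, ?_⟩, hσs.1 (hsel σ hσ)⟩, notMem_erase _ _, hpred σ hσ⟩
    rw [card_erase_of_mem (hsel σ hσ), hσs.2]; rfl
  have hg0 : ∀ x ∈ T, 0 ≤ g x := by
    intro x hx
    simp only [hT, mem_filter, mem_product, mem_powersetCard] at hx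
    exact mul_nonneg (hw _ hx.1.2) (prod_nonneg fun b hb => hw b (hx.1.1.1 hb))
  calc ∑ σ ∈ A, ∏ a ∈ σ, w a = ∑ x ∈ A.image φ, g x := hLHS
    _ ≤ ∑ x ∈ T, g x := sum_le_sum_of_subset_of_nonneg hsub fun x hx _ => hg0 x hx
    _ = ∑ σ' ∈ s.powersetCard k, ∑ p ∈ s with p ∉ σ' ∧ pred σ' p, w p * ∏ a ∈ σ', w a := by
        rw [hT, sum_filter, sum_product]
        refine sum_congr rfl fun σ' _ => ?_
        rw [sum_filter]
    _ = ∑ σ' ∈ s.powersetCard k, (∑ p ∈ s.filter (fun p => p ∉ σ' ∧ pred σ' p), w p) *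
          ∏ a ∈ σ', w a := by
        refine sum_congr rfl fun σ' _ => ?_
        rw [sum_mul]
    _ ≤ ∑ σ' ∈ s.powersetCard k, B * ∏ a ∈ σ', w a := by
        refine sum_le_sum fun σ' hσ' => mul_le_mul_of_nonneg_right (hB σ' hσ') ?_
        exact prod_nonneg fun b hb => hw b ((mem_powersetCard.mp hσ').1 hb)
    _ = B * ∑ σ' ∈ s.powersetCard k, ∏ a ∈ σ', w a := by rw [mul_sum]

/-- **Two distinguished members.** As `sum_sel_le` with a selected ordered pair
`(sel₁ σ, sel₂ σ)` of distinct members satisfying a condition `pred₂` of bounded total weight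
`∑_{(p,p') ∈ s², p ≠ p', pred₂ p p'} w(p)w(p') ≤ B₂`: then `∑_{σ∈A} ∏_σ w ≤ B₂ · e_k(s)` for a
family `A` of `(k+2)`-subsets (the device for "two prime ideals `P_{i−1}, P_i` with
`N(P_i) < N(P_{i−1}) ≤ X^ξ N(P_i)`", p. 43). [cite: HeathBrownActa2001, §7 p. 43] -/
theorem sum_sel₂_le (s : Finset α) (w : α → ℝ) (hw : ∀ a ∈ s, 0 ≤ w a) (k : ℕ)
    (A : Finset (Finset α)) (hA : A ⊆ s.powersetCard (k + 2))
    (sel₁ sel₂ : Finset α → α) (hsel₁ : ∀ σ ∈ A, sel₁ σ ∈ σ) (hsel₂ : ∀ σ ∈ A, sel₂ σ ∈ σ)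
    (hne : ∀ σ ∈ A, sel₁ σ ≠ sel₂ σ)
    (pred₂ : α → α → Prop) [∀ p p', Decidable (pred₂ p p')]
    (hpred : ∀ σ ∈ A, pred₂ (sel₁ σ) (sel₂ σ))
    {B₂ : ℝ} (hB : ∑ x ∈ (s ×ˢ s).filter (fun x => x.1 ≠ x.2 ∧ pred₂ x.1 x.2), w x.1 * w x.2 ≤ B₂) :
    ∑ σ ∈ A, ∏ a ∈ σ, w a ≤ B₂ * ∑ σ' ∈ s.powersetCard k, ∏ a ∈ σ', w a := by
  classical
  set φ : Finset α → Finset α × (α × α) :=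
    fun σ => ((σ.erase (sel₁ σ)).erase (sel₂ σ), (sel₁ σ, sel₂ σ)) with hφ
  set g : Finset α × (α × α) → ℝ := fun x => (w x.2.1 * w x.2.2) * ∏ a ∈ x.1, w a with hg
  have hmem₂ : ∀ σ ∈ A, sel₂ σ ∈ σ.erase (sel₁ σ) := fun σ hσ =>
    mem_erase.mpr ⟨(hne σ hσ).symm, hsel₂ σ hσ⟩
  have hrecon : ∀ σ ∈ A, insert (sel₁ σ) (insert (sel₂ σ) ((σ.erase (sel₁ σ)).erase (sel₂ σ))) = σ := by
    intro σ hσ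
    rw [insert_erase (hmem₂ σ hσ), insert_erase (hsel₁ σ hσ)]
  have hinj : Set.InjOn φ A := by
    intro σ₁ h₁ σ₂ h₂ h
    simp only [hφ, Prod.mk.injEq] at h
    rw [← hrecon σ₁ h₁, h.1, h.2.1, h.2.2, hrecon σ₂ h₂]
  have hLHS : ∑ σ ∈ A, ∏ a ∈ σ, w a = ∑ x ∈ A.image φ, g x := by
    rw [sum_image hinj]
    refine sum_congr rfl fun σ hσ => ?_
    simp only [hg, hφ]
    rw [← mul_prod_erase σ w (hsel₁ σ hσ), ← mul_prod_erase _ w (hmem₂ σ hσ)]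
    ring
  set T : Finset (Finset α × (α × α)) :=
    (s.powersetCard k ×ˢ ((s ×ˢ s).filter (fun x => x.1 ≠ x.2 ∧ pred₂ x.1 x.2))) with hT
  have hsub : A.image φ ⊆ T := by
    intro x hx
    obtain ⟨σ, hσ, rfl⟩ := mem_image.mp hx
    have hσs := mem_powersetCard.mp (hA hσ)
    simp only [hT, hφ, mem_product, mem_powersetCard, mem_filter]
    refine ⟨⟨((erase_subset _ _).trans (erase_subset _ _)).trans hσs.1, ?_⟩,
      ⟨hσs.1 (hsel₁ σ hσ), hσs.1 (hsel₂ σ hσ)⟩, hne σ hσ, hpred σ hσ⟩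
    rw [card_erase_of_mem (hmem₂ σ hσ), card_erase_of_mem (hsel₁ σ hσ), hσs.2]; rfl
  have hg0 : ∀ x ∈ T, 0 ≤ g x := by
    intro x hx
    simp only [hT, mem_product, mem_powersetCard, mem_filter] at hx
    exact mul_nonneg (mul_nonneg (hw _ hx.2.1.1) (hw _ hx.2.1.2))
      (prod_nonneg fun b hb => hw b (hx.1.1 hb))
  calc ∑ σ ∈ A, ∏ a ∈ σ, w a = ∑ x ∈ A.image φ, g x := hLHS
    _ ≤ ∑ x ∈ T, g x := sum_le_sum_of_subset_of_nonneg hsub fun x hx _ => hg0 x hx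
    _ = ∑ σ' ∈ s.powersetCard k, (∑ x ∈ (s ×ˢ s).filter (fun x => x.1 ≠ x.2 ∧ pred₂ x.1 x.2),
          w x.1 * w x.2) * ∏ a ∈ σ', w a := by
        rw [hT, sum_product]
        refine sum_congr rfl fun σ' _ => ?_
        rw [sum_mul]
    _ ≤ ∑ σ' ∈ s.powersetCard k, B₂ * ∏ a ∈ σ', w a := by
        refine sum_le_sum fun σ' hσ' => mul_le_mul_of_nonneg_right hB ?_
        exact prod_nonneg fun b hb => hw b ((mem_powersetCard.mp hσ').1 hb)
    _ = B₂ * ∑ σ' ∈ s.powersetCard k, ∏ a ∈ σ', w a := by rw [mul_sum]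

end Esymm

/-! ### The weight `c_K(q)/q` on the integers and the ideal-weighted sums `∑_{N(Q)∈𝒬} N(Q)^{-1}` -/

open Literature.NumberTheory.LFunctions (idealNormCount idealNormCount_def idealNormCount_one
  idealNormCount_mul_of_coprime idealNormCount_prime_le)

/-- `c_K(q)/q ≥ 0`. [folklore] -/
theorem normWt_nonneg (q : ℕ) : 0 ≤ (idealNormCount K q : ℝ) * (q : ℝ)⁻¹ := by positivity

/-- **`∑_{N(Q) ∈ 𝒬} N(Q)^{-1} = ∑_{q ∈ 𝒬} c_K(q)/q`** (group the ideals by norm; `c_K(q)` of them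
have norm `q`). [cite: HeathBrownActa2001, §7 (7.4)] -/
theorem sum_normIn_inv_absNorm_eq (𝒬 : Finset ℕ) :
    ∑ Q ∈ normIn 𝒬, ((Ideal.absNorm Q : ℕ) : ℝ)⁻¹ = ∑ q ∈ 𝒬, (idealNormCount K q : ℝ) * (q : ℝ)⁻¹ := by
  classical
  rw [← sum_fiberwise_of_maps_to (s := normIn 𝒬) (t := 𝒬) (g := Ideal.absNorm)
    (fun Q hQ => mem_normIn_iff.mp hQ)]
  refine sum_congr rfl fun q hq => ?_
  rw [sum_congr rfl (fun Q hQ => by rw [(mem_filter.mp hQ).2] :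
    ∀ Q ∈ (normIn 𝒬).filter (fun Q => Ideal.absNorm Q = q),
      ((Ideal.absNorm Q : ℕ) : ℝ)⁻¹ = (q : ℝ)⁻¹),
    sum_const, nsmul_eq_mul, card_filter_normIn_absNorm_eq hq]

/-- **`c_K` of a product of distinct rational primes is the product of the `c_K(p)`**
(multiplicativity on coprime arguments). [folklore] -/
theorem idealNormCount_prod_primes (σ : Finset ℕ) (hσ : ∀ p ∈ σ, p.Prime) :
    idealNormCount K (∏ p ∈ σ, p) = ∏ p ∈ σ, idealNormCount K p := by
  classical
  induction σ using Finset.induction_on with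
  | empty => simp [idealNormCount_one]
  | insert a s ha ih =>
    have hs : ∀ p ∈ s, p.Prime := fun p hp => hσ p (mem_insert_of_mem hp)
    have hap : a.Prime := hσ a (mem_insert_self a s)
    have hcop : a.Coprime (∏ p ∈ s, p) :=
      Nat.Coprime.prod_right fun p hp =>
        (Nat.coprime_primes hap (hs p hp)).mpr fun h => ha (h ▸ hp)
    rw [prod_insert ha, prod_insert ha, idealNormCount_mul_of_coprime K hcop, ih hs]

/-- `c_K(∏σ)/∏σ = ∏_{p∈σ} c_K(p)/p` for a set `σ` of distinct rational primes. [folklore] -/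
theorem normWt_prod_primes (σ : Finset ℕ) (hσ : ∀ p ∈ σ, p.Prime) :
    (idealNormCount K (∏ p ∈ σ, p) : ℝ) * ((∏ p ∈ σ, p : ℕ) : ℝ)⁻¹ = ∏ p ∈ σ, (idealNormCount K p : ℝ) * (p : ℝ)⁻¹ := by
  rw [idealNormCount_prod_primes σ hσ, Nat.cast_prod, Nat.cast_prod, ← prod_inv_distrib,
    ← prod_mul_distrib]

/-- The ideal weight of a family of norms given as products of sets of distinct primes is at most
the sum over the sets of the product weights (with equality when the sets are distinct as products;
the inequality is all that is used). [cite: HeathBrownActa2001, §7 (7.4)] -/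
theorem sum_image_prod_normWt_le (A : Finset (Finset ℕ)) (hA : ∀ σ ∈ A, ∀ p ∈ σ, p.Prime) :
    ∑ q ∈ A.image (fun σ => ∏ p ∈ σ, p), (idealNormCount K q : ℝ) * (q : ℝ)⁻¹ ≤ ∑ σ ∈ A, ∏ p ∈ σ, (idealNormCount K p : ℝ) * (p : ℝ)⁻¹ := by
  classical
  calc ∑ q ∈ A.image (fun σ => ∏ p ∈ σ, p), (idealNormCount K q : ℝ) * (q : ℝ)⁻¹ ≤ ∑ σ ∈ A, (idealNormCount K (∏ p ∈ σ, p) : ℝ) * ((∏ p ∈ σ, p : ℕ) : ℝ)⁻¹ :=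
        sum_image_le_of_nonneg fun σ _ => normWt_nonneg _
    _ = ∑ σ ∈ A, ∏ p ∈ σ, (idealNormCount K p : ℝ) * (p : ℝ)⁻¹ := sum_congr rfl fun σ hσ => normWt_prod_primes σ (hA σ hσ)

/-! ### Dyadic summation of the corrected Lemma 7.1 (normIn form) -/

/-- **Lemma 7.1 (corrected, `normIn` form) summed dyadically.** If a function `S` of ideals
satisfies the conclusion of `HeathBrown2001_lemma_7_1_normWeighted` on every dyadic block — for every
finite set `𝒬` of square-free integers in `(N, 2N]`, `0 < N ≤ X^{2−2τ}`,
`∑_{N(Q)∈𝒬} S(Q) ≤ C (M/log min(z, X^{2−τ}/N) · ∑_{N(Q)∈𝒬} N(Q)^{-1} + Err)` — then for every finite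
set `𝒬` of square-free integers in `[a, b)`, `2 ≤ a ≤ b ≤ X^{2−2τ}`, `min(z, X^{2−τ}/b) > 1`,
`∑_{N(Q)∈𝒬} S(Q) ≤ C (M/log min(z, X^{2−τ}/b)) ∑_{q∈𝒬} c_K(q)/q + (log b/log 2 + 1) C·Err`.
This is how Lemma 7.1 is applied on pp. 42–47 ((7.3)). [cite: HeathBrownActa2001, §7 (7.3)] -/
theorem dyadic_sum_normIn_le {X τ z C M Err a b : ℝ} {S : Ideal (𝓞 K) → ℝ}
    (h71 : ∀ (N : ℝ) (𝒬 : Finset ℕ), 0 < N → N ≤ X ^ (2 - 2 * τ) →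
        (∀ q ∈ 𝒬, Squarefree q ∧ N < q ∧ (q : ℝ) ≤ 2 * N) →
        ∑ Q ∈ normIn 𝒬, S Q ≤
          C * (M / Real.log (min z (X ^ (2 - τ) / N)) *
            ∑ Q ∈ normIn 𝒬, ((Ideal.absNorm Q : ℕ) : ℝ)⁻¹ + Err))
    (hC : 0 ≤ C) (hM : 0 ≤ M) (hErr : 0 ≤ Err) (hX : 0 < X) (ha : 2 ≤ a) (hab : a ≤ b)
    (hb : b ≤ X ^ (2 - 2 * τ)) (hm : 1 < min z (X ^ (2 - τ) / b))
    (𝒬 : Finset ℕ) (h𝒬 : ∀ q ∈ 𝒬, Squarefree q ∧ a ≤ (q : ℝ) ∧ (q : ℝ) < b) :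
    ∑ Q ∈ normIn 𝒬, S Q ≤
      C * (M / Real.log (min z (X ^ (2 - τ) / b)) * ∑ q ∈ 𝒬, (idealNormCount K q : ℝ) * (q : ℝ)⁻¹) +
        (Real.log b / Real.log 2 + 1) * (C * Err) := by
  have h71' : ∀ (N : ℝ) (𝒬 : Finset ℕ), 0 < N → N ≤ X ^ (2 - 2 * τ) →
      (∀ q ∈ 𝒬, Squarefree q ∧ N < q ∧ (q : ℝ) ≤ 2 * N) →
      ∑ Q ∈ normIn 𝒬, S Q ≤
        C * (M / Real.log (min z (X ^ (2 - τ) / N)) * ∑ q ∈ 𝒬, (idealNormCount K q : ℝ) * (q : ℝ)⁻¹ + Err) := by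
    intro N 𝒬 hN hNX h
    have := h71 N 𝒬 hN hNX h
    rwa [sum_normIn_inv_absNorm_eq] at this
  -- `dyadic_sum_le` is stated with the weight `q⁻¹`; its proof is weight-agnostic, and we re-run it
  classical
  set ℓ : ℝ := Real.log (min z (X ^ (2 - τ) / b)) with hℓ
  have hℓ0 : 0 < ℓ := Real.log_pos hm
  have hb2 : 2 ≤ b := ha.trans hab
  have hXp : 0 < X ^ (2 - τ) := Real.rpow_pos_of_pos hX _
  have hq2 : ∀ q ∈ 𝒬, 2 ≤ q := fun q hq => by
    have h := ha.trans (h𝒬 q hq).2.1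
    exact_mod_cast h
  set J : Finset ℕ := 𝒬.image dyadIdx with hJ
  set blk : ℕ → Finset ℕ := fun j => 𝒬.filter fun q => dyadIdx q = j with hblk
  have hfib : ∀ j, (normIn 𝒬).filter (fun Q => dyadIdx (Ideal.absNorm Q) = j) = normIn (blk j) := by
    intro j
    ext Q
    simp only [mem_filter, mem_normIn_iff, hblk]
  have hblock : ∀ j ∈ J, ∑ Q ∈ normIn (blk j), S Q ≤
      C * (M / ℓ * ∑ q ∈ blk j, (idealNormCount K q : ℝ) * (q : ℝ)⁻¹) + C * Err := by
    intro j hj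
    obtain ⟨q₀, hq₀, hjq₀⟩ := mem_image.mp hj
    have hNpos : (0 : ℝ) < (2 : ℝ) ^ j := by positivity
    have hNb : (2 : ℝ) ^ j < b := by
      calc (2 : ℝ) ^ j = ((2 ^ dyadIdx q₀ : ℕ) : ℝ) := by rw [← hjq₀]; push_cast; ring
        _ < q₀ := by exact_mod_cast pow_dyadIdx_lt (hq2 q₀ hq₀)
        _ < b := (h𝒬 q₀ hq₀).2.2
    have hNX : (2 : ℝ) ^ j ≤ X ^ (2 - 2 * τ) := hNb.le.trans hb
    have hmem : ∀ q ∈ blk j, Squarefree q ∧ (2 : ℝ) ^ j < q ∧ (q : ℝ) ≤ 2 * (2 : ℝ) ^ j := by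
      intro q hq
      rw [hblk, mem_filter] at hq
      obtain ⟨hq𝒬, hqj⟩ := hq
      refine ⟨(h𝒬 q hq𝒬).1, ?_, ?_⟩
      · calc (2 : ℝ) ^ j = ((2 ^ dyadIdx q : ℕ) : ℝ) := by rw [← hqj]; push_cast; ring
          _ < q := by exact_mod_cast pow_dyadIdx_lt (hq2 q hq𝒬)
      · calc (q : ℝ) ≤ ((2 ^ (dyadIdx q + 1) : ℕ) : ℝ) := by exact_mod_cast le_pow_dyadIdx_succ q
          _ = 2 * (2 : ℝ) ^ j := by rw [← hqj]; push_cast; ring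
    have h := h71' ((2 : ℝ) ^ j) (blk j) hNpos hNX hmem
    have hmin : min z (X ^ (2 - τ) / b) ≤ min z (X ^ (2 - τ) / (2 : ℝ) ^ j) :=
      min_le_min le_rfl (div_le_div_of_nonneg_left hXp.le hNpos hNb.le)
    have hlog : ℓ ≤ Real.log (min z (X ^ (2 - τ) / (2 : ℝ) ^ j)) :=
      Real.log_le_log (zero_lt_one.trans hm) hmin
    have hsum0 : 0 ≤ ∑ q ∈ blk j, (idealNormCount K q : ℝ) * (q : ℝ)⁻¹ := sum_nonneg fun q _ => normWt_nonneg q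
    calc ∑ Q ∈ normIn (blk j), S Q
        ≤ C * (M / Real.log (min z (X ^ (2 - τ) / (2 : ℝ) ^ j)) * ∑ q ∈ blk j, (idealNormCount K q : ℝ) * (q : ℝ)⁻¹ + Err) := h
      _ ≤ C * (M / ℓ * ∑ q ∈ blk j, (idealNormCount K q : ℝ) * (q : ℝ)⁻¹ + Err) := by
          have : M / Real.log (min z (X ^ (2 - τ) / (2 : ℝ) ^ j)) ≤ M / ℓ :=
            div_le_div_of_nonneg_left hM hℓ0 hlog
          gcongr
      _ = C * (M / ℓ * ∑ q ∈ blk j, (idealNormCount K q : ℝ) * (q : ℝ)⁻¹) + C * Err := by ring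
  have hLHS : ∑ Q ∈ normIn 𝒬, S Q = ∑ j ∈ J, ∑ Q ∈ normIn (blk j), S Q := by
    rw [← sum_fiberwise_of_maps_to (s := normIn 𝒬) (t := J)
      (g := fun Q => dyadIdx (Ideal.absNorm Q))
      (fun Q hQ => mem_image_of_mem _ (mem_normIn_iff.mp hQ))]
    exact sum_congr rfl fun j _ => by rw [hfib]
  have hrecip : ∑ j ∈ J, ∑ q ∈ blk j, (idealNormCount K q : ℝ) * (q : ℝ)⁻¹ = ∑ q ∈ 𝒬, (idealNormCount K q : ℝ) * (q : ℝ)⁻¹ := by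
    rw [hblk]
    exact sum_fiberwise_of_maps_to (g := dyadIdx) (fun q hq => mem_image_of_mem _ hq) _
  have hcardJ : (#J : ℝ) ≤ Real.log b / Real.log 2 + 1 := by
    have hsub : J ⊆ range (⌊Real.log b / Real.log 2⌋₊ + 1) := by
      intro j hj
      obtain ⟨q₀, hq₀, rfl⟩ := mem_image.mp hj
      rw [mem_range, Nat.lt_add_one_iff]
      exact Nat.le_floor (dyadIdx_le_log (hq2 q₀ hq₀) (h𝒬 q₀ hq₀).2.2)
    have hlog0 : 0 ≤ Real.log b / Real.log 2 :=
      div_nonneg (Real.log_nonneg (by linarith)) (Real.log_nonneg one_le_two)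
    calc (#J : ℝ) ≤ #(range (⌊Real.log b / Real.log 2⌋₊ + 1)) := by exact_mod_cast card_le_card hsub
      _ = (⌊Real.log b / Real.log 2⌋₊ : ℝ) + 1 := by rw [card_range]; push_cast; ring
      _ ≤ Real.log b / Real.log 2 + 1 := by linarith [Nat.floor_le hlog0]
  have hCErr : 0 ≤ C * Err := mul_nonneg hC hErr
  calc ∑ Q ∈ normIn 𝒬, S Q = ∑ j ∈ J, ∑ Q ∈ normIn (blk j), S Q := hLHS
    _ ≤ ∑ j ∈ J, (C * (M / ℓ * ∑ q ∈ blk j, (idealNormCount K q : ℝ) * (q : ℝ)⁻¹) + C * Err) := sum_le_sum hblock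
    _ = C * (M / ℓ * ∑ q ∈ 𝒬, (idealNormCount K q : ℝ) * (q : ℝ)⁻¹) + #J * (C * Err) := by
        rw [sum_add_distrib, sum_const, nsmul_eq_mul, ← hrecip, mul_sum, mul_sum]
    _ ≤ C * (M / ℓ * ∑ q ∈ 𝒬, (idealNormCount K q : ℝ) * (q : ℝ)⁻¹) + (Real.log b / Real.log 2 + 1) * (C * Err) := by
        gcongr

/-! ### Mertens' theorem for the first-degree prime ideals: windows of norms -/

/-- **Mertens over windows, sharp form** (from the tree's Mertens theorem for the degree-one primes
with rate, `Literature.NumberTheory.LFunctions.NumberField.sum_primesLE_idealNormCount_div_eq`):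
there is `C₁ ≥ 0` such that for all `2 ≤ lo ≤ hi` and every set `T` of primes contained in
`(lo, hi]`, `∑_{p ∈ T} c_K(p)/p ≤ log(log hi/log lo) + C₁/log lo`. Summed over the first-degree
prime ideals this is (7.1)–(7.2), p. 42: `∑_{z ≤ N(P) < zX^ξ} N(P)^{-1} ≪ ξτ^{-1}` (`z ≥ X^τ`) and
`∑_{X^τ ≤ N(P) < X^{1−τ}} N(P)^{-1} ≤ log τ^{-1} + O(1)` — with the constant `1` in front of the
logarithm, which the bookkeeping of pp. 42–44 (`(log τ^{-1})^n/n!` summed over `n ≪ τ^{-1}`) requires.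
[cite: HeathBrownActa2001, §7 (7.1)–(7.2)] -/
theorem exists_sum_normWt_window_le :
    ∃ C₁ : ℝ, 0 ≤ C₁ ∧ ∀ (lo hi : ℝ) (T : Finset ℕ), 2 ≤ lo → lo ≤ hi →
      (∀ p ∈ T, p.Prime ∧ lo < (p : ℝ) ∧ (p : ℝ) ≤ hi) →
      ∑ p ∈ T, (idealNormCount K p : ℝ) * (p : ℝ)⁻¹ ≤ Real.log (Real.log hi / Real.log lo) + C₁ / Real.log lo := by
  classical
  obtain ⟨c, C, hK⟩ :=
    Literature.NumberTheory.LFunctions.NumberField.sum_primesLE_idealNormCount_div_eq K 0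
  have hC0 : 0 ≤ C := by
    have h := hK 2 le_rfl
    have hl2 : 0 < Real.log 2 := Real.log_pos one_lt_two
    rw [zero_add, pow_one] at h
    by_contra hneg
    have : C / Real.log 2 < 0 := div_neg_of_neg_of_pos (not_le.mp hneg) hl2
    linarith [abs_nonneg ((∑ p ∈ Nat.primesLE ⌊(2 : ℝ)⌋₊, (idealNormCount K p : ℝ) / p) -
      (Real.log (Real.log 2) + c))]
  refine ⟨2 * C, by positivity, fun lo hi T hlo hlohi hT => ?_⟩
  set S : ℝ → ℝ := fun x => ∑ p ∈ Nat.primesLE ⌊x⌋₊, (idealNormCount K p : ℝ) / p with hSdef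
  have hlo1 : 1 < lo := by linarith
  have hllo : 0 < Real.log lo := Real.log_pos hlo1
  have hlhi : Real.log lo ≤ Real.log hi := Real.log_le_log (by linarith) hlohi
  have hlhi0 : 0 < Real.log hi := hllo.trans_le hlhi
  have hTsub : T ⊆ Nat.primesLE ⌊hi⌋₊ \ Nat.primesLE ⌊lo⌋₊ := by
    intro p hp
    obtain ⟨hpp, hplo, hphi⟩ := hT p hp
    refine Finset.mem_sdiff.mpr ⟨Nat.mem_primesLE.mpr ⟨Nat.le_floor hphi, hpp⟩, fun h => ?_⟩
    have : (p : ℝ) ≤ lo := (Nat.le_floor_iff (by linarith)).mp (Nat.mem_primesLE.mp h).1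
    linarith
  have hsub' : Nat.primesLE ⌊lo⌋₊ ⊆ Nat.primesLE ⌊hi⌋₊ := by
    intro p hp
    rw [Nat.mem_primesLE] at hp ⊢
    exact ⟨hp.1.trans (Nat.floor_le_floor hlohi), hp.2⟩
  have hwin : ∑ p ∈ T, (idealNormCount K p : ℝ) * (p : ℝ)⁻¹ ≤ S hi - S lo := by
    calc ∑ p ∈ T, (idealNormCount K p : ℝ) * (p : ℝ)⁻¹
        ≤ ∑ p ∈ Nat.primesLE ⌊hi⌋₊ \ Nat.primesLE ⌊lo⌋₊, (idealNormCount K p : ℝ) * (p : ℝ)⁻¹ :=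
          sum_le_sum_of_subset_of_nonneg hTsub fun p _ _ => normWt_nonneg p
      _ = S hi - S lo := by
          rw [hSdef]
          simp only [← div_eq_mul_inv]
          rw [sum_sdiff_eq_sub hsub']
  have h1 := abs_le.mp (hK hi (hlo.trans hlohi))
  have h2 := abs_le.mp (hK lo hlo)
  rw [zero_add, pow_one] at h1 h2
  have hKhi : C / Real.log hi ≤ C / Real.log lo := div_le_div_of_nonneg_left hC0 hllo hlhi
  calc ∑ p ∈ T, (idealNormCount K p : ℝ) * (p : ℝ)⁻¹ ≤ S hi - S lo := hwin
    _ ≤ (Real.log (Real.log hi) + c + C / Real.log hi) -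
          (Real.log (Real.log lo) + c - C / Real.log lo) := by
        have e1 : S hi ≤ Real.log (Real.log hi) + c + C / Real.log hi := by
          have := h1.2; rw [hSdef]; linarith
        have e2 : Real.log (Real.log lo) + c - C / Real.log lo ≤ S lo := by
          have := h2.1; rw [hSdef]; linarith
        linarith
    _ ≤ Real.log (Real.log hi / Real.log lo) + 2 * C / Real.log lo := by
        rw [Real.log_div hlhi0.ne' hllo.ne', mul_div_assoc]; linarith

/-- `log(log hi/log lo) ≤ log(hi/lo)/log lo` for `1 < lo ≤ hi` (`log u ≤ u − 1`). [folklore] -/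
theorem log_log_div_log_le {lo hi : ℝ} (hlo : 1 < lo) (hlohi : lo ≤ hi) :
    Real.log (Real.log hi / Real.log lo) ≤ Real.log (hi / lo) / Real.log lo := by
  have hllo : 0 < Real.log lo := Real.log_pos hlo
  have hlhi0 : 0 < Real.log hi := hllo.trans_le (Real.log_le_log (by linarith) hlohi)
  rw [Real.log_div (x := hi) (y := lo) (by linarith) (by linarith)]
  have h := Real.log_le_sub_one_of_pos (div_pos hlhi0 hllo)
  calc Real.log (Real.log hi / Real.log lo) ≤ Real.log hi / Real.log lo - 1 := h
    _ = (Real.log hi - Real.log lo) / Real.log lo := by field_simp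

end Literature.NumberTheory.Sieve.CubicSieve

end
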